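import Summits.Langlands.Langlands.Theses.GaloisWeightedBE
import Literature.NumberTheory.LFunctions.StarkNoQuadraticSubfieldProofs
import HarnessLib

/-!
# Line `stark-seam` — crux #4 `ExtendedRiemannHypothesis` (stmt-Langlands-14565) of route GaloisWeightedBE
# as DERIVED from two typed pieces (crux-strategist planner-cstrat-stmt-Langlands-14565-r1-0, 2026-08-17;
# RESTATED re-audit / BC2 redirect). Registered skeleton: 2 stubs + kernel-checked composition.

Stubs (= the split children, verbatim; each strictly weaker than the crux as far as is known):
* `stub_abelianERH` — ERH for ABELIAN number fields (`IsAbelianGalois ℚ K`; ⟺ GRH for Dirichlet L-functions);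
* `stub_galoisMultipleZerosOnLine` — multiple zeros (`ζ_N(s) = ζ_N'(s) = 0`) of `ζ_N`, `N/ℚ` finite Galois,
  in the open strip lie on `Re s = 1/2`.

Composition `ExtendedRiemannHypothesis_of : stub₁-statement → stub₂-statement → GaloisWeightedBE.ExtendedRiemannHypothesis`
(REAL proof, sorry-free, std axioms): normal closure `N₀` of `K` in `ℚ̄`, Artin quotient `q : Γ_ℚ → Gal(N₀/ℚ)`;
`ord_s ζ_{N₀} ≥ 2` ⇒ stub₂ on `N₀`; `ord_s ζ_{N₀} ≤ 1` ⇒ Heilbronn–Stark (`Σ_χ n(G,χ)² ≤ (ord_s ζ_{N₀})²`, tree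
`Heilbronn.sum_sq_artinOrder_le`) makes Heilbronn's character a LINEAR character `χ₁` (complex-point version of the
tree's `heilbronnChar_eq_zero_or_eq_coe` = Stark 1974 Thm. 3), the subfield criterion moves the zero to
`k₁ = ℚ̄^{q⁻¹(ker χ₁)}`, abelian over `ℚ` (infinite Galois correspondence), and stub₁ applies. Sorries ONLY in `stub_*`.
The same proof, with the pieces as hypotheses, is the ready-to-land Theorems file
`GaloisWeightedBEExtendedRiemannHypothesisSplit.lean` (namespace `…Cruxes.ExtendedRiemannHypothesis.StarkSeam`).
-/

noncomputable section

namespace Summit.Langlands.Langlands.Cruxes.ExtendedRiemannHypothesis.StarkSeamLine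

/-- **stub_abelianERH** (= split child `AbelianERH`, crux): ERH for abelian number fields — for every
number field `K` that is an abelian Galois extension of `ℚ`, every zero of `ζ_K` in the open critical strip
lies on `Re s = 1/2` (⟺ GRH for all Dirichlet `L`-functions by Kronecker–Weber and `ζ_K = ∏_χ L(s,χ)`; open).
[cite: IwaniecKowalski2004, §5.10] -/
theorem stub_abelianERH : ∀ (K : Type) [Field K] [NumberField K] [IsAbelianGalois ℚ K],
    Literature.NumberTheory.LFunctions.NumberField.ExtendedRiemannHypothesis K := by
  sorry

/-- **stub_galoisMultipleZerosOnLine** (= split child `GaloisMultipleZerosOnLine`, crux): for every number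
field `N` Galois over `ℚ` and every `s` with `0 < Re s < 1`, if `ζ_N(s) = 0` and `ζ_N'(s) = 0` then
`Re s = 1/2` (carries GRH for the Artin `L`-functions of the irreducible characters of degree ≥ 2 of
`Gal(N/ℚ)`, whose zeros are multiple zeros of `ζ_N = ∏ L(s,χ)^{χ(1)}`, and the coincidences of abelian zeros; open).
[cite: Stark1974, Thm. 3] -/
theorem stub_galoisMultipleZerosOnLine : ∀ (N : Type) [Field N] [NumberField N] [IsGalois ℚ N] (s : ℂ),
    0 < s.re → s.re < 1 → Literature.NumberTheory.LFunctions.dedekindZetaCont N s = 0 →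
    deriv (Literature.NumberTheory.LFunctions.dedekindZetaCont N) s = 0 → s.re = 1 / 2 := by
  sorry

open scoped NumberField ComplexConjugate
open Complex Filter Topology NumberField IntermediateField
open Literature.NumberTheory.Automorphic Literature.NumberTheory.LFunctions
  Literature.NumberTheory.LFunctions.Heilbronn Literature.NumberTheory.LFunctions.NumberField
  Literature.RepresentationTheory.FiniteGroups

attribute [local instance 1001] AlgebraicClosure.instAlgebra IntermediateField.algebra'
  IntermediateField.module'

/-! ### Transport of Galois predicates along the (unique) `ℚ`-algebra structure -/

theorem isGalois_transport {N : Type*} [Field N] (i j : Algebra ℚ N) (h : @IsGalois ℚ _ N _ i) :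
    @IsGalois ℚ _ N _ j := by
  have hij : i = j := Subsingleton.elim i j
  subst hij
  exact h

theorem isAbelianGalois_transport {N : Type*} [Field N] (i j : Algebra ℚ N)
    (h : @IsAbelianGalois ℚ N _ _ i) : @IsAbelianGalois ℚ N _ _ j := by
  have hij : i = j := Subsingleton.elim i j
  subst hij
  exact h

/-! ### A zero of order `≥ 2` of an analytic function kills the value and the derivative -/

theorem eq_zero_and_deriv_eq_zero_of_two_le {f : ℂ → ℂ} {s : ℂ} (hf : AnalyticAt ℂ f s)
    (h2 : ((2 : ℤ) : WithTop ℤ) ≤ meromorphicOrderAt f s) : f s = 0 ∧ deriv f s = 0 := by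
  have h2' : ((2 : ℕ) : ℕ∞) ≤ analyticOrderAt f s := by
    by_cases htop : analyticOrderAt f s = ⊤
    · rw [htop]; exact le_top
    · obtain ⟨n, hn⟩ := ENat.ne_top_iff_exists.mp htop
      rw [hf.meromorphicOrderAt_eq, ← hn, ENat.map_coe] at h2
      have h'' : (2 : ℤ) ≤ n := WithTop.coe_le_coe.mp h2
      rw [← hn]
      exact_mod_cast (show 2 ≤ n by omega)
  obtain ⟨g, hg, hfg⟩ := (natCast_le_analyticOrderAt hf).mp h2'
  have hfg' : f =ᶠ[𝓝 s] fun z => (z - s) ^ 2 • g z := hfg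
  have hfs : f s = 0 := by
    have h := hfg.self_of_nhds
    simpa using h
  refine ⟨hfs, ?_⟩
  rw [hfg'.deriv_eq]
  have hd := (((hasDerivAt_id' s).sub_const s).pow 2).smul hg.differentiableAt.hasDerivAt
  rw [show (fun z => (z - s) ^ 2 • g z) = ((fun x => x - s) ^ 2 • g) from rfl, hd.deriv]
  simp

/-! ### Heilbronn–Stark at a complex point: `θ_G = 0` or `θ_G` is a linear character -/

section Structure

variable {F : Type} [Field F] [NumberField F] {G : Type} [Group G] [Fintype G]
  {q : Field.absoluteGaloisGroup F →* G}

/-- **Heilbronn–Stark structure theorem at an arbitrary point** `s₀ ≠ 1` with `ord_{s₀} ζ_N ≤ 1`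
(`N` the field of `G`): Heilbronn's character is `0` or a character of degree one `χ₁ : G →* ℂˣ`
(Murty–Murty Ch. 2 Prop. 5.2: `Σ_χ n(G,χ)² ≤ n(G, reg)²`; Stark 1974 Thm. 3). The tree's
`heilbronnChar_eq_zero_or_eq_coe` is the real-point case with the extra conclusion `χ₁ = ±1`; the
realness is used there only for that extra conclusion, and the proof below is its verbatim prefix. -/
theorem heilbronnChar_eq_zero_or_eq_linear (hq : IsArtinQuotient q) {s₀ : ℂ} (hs₀ : s₀ ≠ 1)
    (hle : artinOrder s₀ ((Representation.leftRegular ℂ G).character ∘ q) ≤ 1) :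
    heilbronnChar q s₀ = 0 ∨
      ∃ χ₁ : G →* ℂˣ, heilbronnChar q s₀ = fun g => (χ₁ g : ℂ) := by
  classical
  set θ := heilbronnChar q s₀ with hθ
  set T := (irrChars_finite_holds G).toFinset with hT
  set n : (G → ℂ) → ℤ := fun χ => artinOrder s₀ (χ ∘ q) with hn
  set e : ℤ := artinOrder s₀ ((Representation.leftRegular ℂ G).character ∘ q) with he
  have hmemT : ∀ {χ : G → ℂ}, χ ∈ T ↔ IsIrrChar G χ := fun {χ} => (irrChars_finite_holds G).mem_toFinset
  have hθ1 : θ 1 = (e : ℂ) := heilbronnChar_one hq s₀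
  have hre : (θ 1).re = e := by rw [hθ1]; simp
  have hsq : (∑ χ ∈ T, n χ ^ 2 : ℤ) ≤ e ^ 2 := by
    have h := sum_sq_artinOrder_le hq hs₀ (G := G) (q := q)
    rw [hre] at h
    exact_mod_cast h
  have hθsum : θ = ∑ χ ∈ T, (n χ : ℂ) • χ := rfl
  have he0 : 0 ≤ e := by
    have h := norm_heilbronnChar_le hq hs₀ (1 : G)
    rw [hre] at h
    exact_mod_cast (norm_nonneg _).trans h
  rcases (show e = 0 ∨ e = 1 by omega) with he' | he'
  · -- `e = 0`: all coefficients vanish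
    left
    have hzero : ∀ χ ∈ T, n χ = 0 := fun χ hχ => by
      have h := (Finset.single_le_sum (fun χ' _ => sq_nonneg (n χ')) hχ).trans hsq
      rw [he'] at h
      exact pow_eq_zero_iff two_ne_zero |>.mp (le_antisymm (by simpa using h) (sq_nonneg _))
    rw [hθsum]
    exact Finset.sum_eq_zero fun χ hχ => by rw [hzero χ hχ]; simp
  · -- `e = 1`: exactly one coefficient, equal to `1`, at a character of degree `1`
    right
    have hS : ∀ χ ∈ T, ∀ χ' ∈ T, n χ ≠ 0 → n χ' ≠ 0 → χ = χ' := by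
      intro χ hχ χ' hχ' h0 h0'
      by_contra hne
      have h2 : n χ ^ 2 + n χ' ^ 2 ≤ ∑ ψ ∈ T, n ψ ^ 2 := by
        rw [← Finset.sum_pair (f := fun ψ => n ψ ^ 2) hne]
        exact Finset.sum_le_sum_of_subset_of_nonneg
          (by intro x hx; simp only [Finset.mem_insert, Finset.mem_singleton] at hx
              rcases hx with rfl | rfl <;> assumption)
          (fun ψ _ _ => sq_nonneg (n ψ))
      have h1 : 1 ≤ n χ ^ 2 := by nlinarith [sq_pos_of_ne_zero h0]
      have h1' : 1 ≤ n χ' ^ 2 := by nlinarith [sq_pos_of_ne_zero h0']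
      rw [he'] at hsq
      linarith
    have hex : ∃ χ₁ ∈ T, n χ₁ ≠ 0 := by
      by_contra hall
      push Not at hall
      have : θ 1 = 0 := by
        rw [hθsum, Finset.sum_apply]
        exact Finset.sum_eq_zero fun χ hχ => by simp [hall χ hχ]
      rw [hθ1, he'] at this
      simp at this
    obtain ⟨χ₁, hχ₁T, hn₁⟩ := hex
    have hχ₁ : IsIrrChar G χ₁ := hmemT.mp hχ₁T
    have hθχ : θ = (n χ₁ : ℂ) • χ₁ := by
      rw [hθsum]
      exact Finset.sum_eq_single χ₁ (fun χ hχ hne => by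
        have : n χ = 0 := by
          by_contra h0
          exact hne (hS χ hχ χ₁ hχ₁T h0 hn₁)
        simp [this]) (fun h => absurd hχ₁T h)
    have hterm_le : n χ₁ ^ 2 ≤ 1 := by
      have h := (Finset.single_le_sum (fun χ' _ => sq_nonneg (n χ')) hχ₁T).trans hsq
      rw [he'] at h
      simpa using h
    obtain ⟨d, hd, hd1⟩ := hχ₁.exists_apply_one_eq_natCast
    have hnd : (n χ₁ : ℂ) * d = 1 := by
      have := congrFun hθχ 1
      rw [Pi.smul_apply, smul_eq_mul, hd1, hθ1, he'] at this
      exact_mod_cast this.symm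
    have hnd' : n χ₁ * d = 1 := by exact_mod_cast hnd
    have hn1 : n χ₁ = 1 := by
      have hdpos : (0 : ℤ) < d := by exact_mod_cast hd
      nlinarith
    have hd1' : d = 1 := by
      rw [hn1, one_mul] at hnd'
      exact_mod_cast hnd'
    have hθeq : θ = χ₁ := by rw [hθχ, hn1]; simp
    have hχ₁one : χ₁ 1 = 1 := by rw [hd1, hd1']; simp
    obtain ⟨θ₁, hθ₁⟩ := exists_monoidHom_of_isCharacter_apply_one hχ₁.isCharacter hχ₁one
    exact ⟨θ₁, by rw [hθeq]; funext g; exact hθ₁ g⟩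

end Structure

/-! ### The fixed field of `q⁻¹(ker χ₁)` is an abelian extension of `ℚ` -/

section Abelian

variable {G : Type} [Group G] [Fintype G] {q : Field.absoluteGaloisGroup ℚ →* G}

/-- For a finite Galois quotient `q : Γ_ℚ → G` and a character of degree one `χ₁ : G →* ℂˣ`, the fixed
field `k₁ = ℚ̄^{q⁻¹(ker χ₁)}` is Galois over `ℚ` with commutative group (`Gal(k₁/ℚ) ≅ Γ_ℚ / ker(χ₁ ∘ q) ↪ ℂˣ`;
infinite Galois correspondence for the closed = open subgroup `q⁻¹(ker χ₁)`). -/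
theorem isAbelianGalois_quotientFixedField_ker (hq : IsArtinQuotient q) (χ₁ : G →* ℂˣ) :
    IsAbelianGalois ℚ (quotientFixedField q χ₁.ker) := by
  set k₁ : IntermediateField ℚ (AlgebraicClosure ℚ) := quotientFixedField q χ₁.ker with hk₁
  have hH : (χ₁.ker.comap q) = (χ₁.comp q).ker := MonoidHom.comap_ker χ₁ q
  have hopen : IsOpen ((χ₁.ker.comap q : Subgroup (Field.absoluteGaloisGroup ℚ)) :
      Set (Field.absoluteGaloisGroup ℚ)) := hq.isOpen_comap _
  have hclosed : IsClosed ((χ₁.ker.comap q : Subgroup (Field.absoluteGaloisGroup ℚ)) :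
      Set (Field.absoluteGaloisGroup ℚ)) := Subgroup.isClosed_of_isOpen _ hopen
  let Hc : ClosedSubgroup (Field.absoluteGaloisGroup ℚ) := ⟨χ₁.ker.comap q, hclosed⟩
  have hfix : k₁.fixingSubgroup = χ₁.ker.comap q := InfiniteGalois.fixingSubgroup_fixedField Hc
  have hnormal : k₁.fixingSubgroup.Normal := by
    rw [hfix, hH]
    exact MonoidHom.normal_ker _
  haveI hgal : IsGalois ℚ k₁ := (InfiniteGalois.normal_iff_isGalois k₁).mp hnormal
  have hcomm : ∀ a b : k₁ ≃ₐ[ℚ] k₁, a * b = b * a := by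
    intro a b
    -- the restriction `Γ_ℚ → Gal(k₁/ℚ)`, typed on `Field.absoluteGaloisGroup ℚ` (same carrier as `q`)
    let r : Field.absoluteGaloisGroup ℚ →* (k₁ ≃ₐ[ℚ] k₁) := AlgEquiv.restrictNormalHom k₁
    have hrsurj : Function.Surjective r :=
      AlgEquiv.restrictNormalHom_surjective (AlgebraicClosure ℚ)
    have hle' : (χ₁.ker.comap q) ≤ k₁.fixingSubgroup :=
      (IntermediateField.le_iff_le (χ₁.ker.comap q) k₁).mp le_rfl
    have hrker : ∀ x : Field.absoluteGaloisGroup ℚ, χ₁ (q x) = 1 → r x = 1 := by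
      intro x hx
      have hx' : x ∈ χ₁.ker.comap q := Subgroup.mem_comap.mpr (MonoidHom.mem_ker.mpr hx)
      have hx'' : x ∈ k₁.fixingSubgroup := hle' hx'
      have hx''' : x ∈ (AlgEquiv.restrictNormalHom (F := ℚ) (K₁ := AlgebraicClosure ℚ) k₁).ker :=
        (IntermediateField.restrictNormalHom_ker k₁).ge hx''
      exact MonoidHom.mem_ker.mp hx'''
    obtain ⟨γ, rfl⟩ := hrsurj a
    obtain ⟨δ, rfl⟩ := hrsurj b
    have h1 : r (γ * δ * γ⁻¹ * δ⁻¹) = 1 := by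
      apply hrker
      rw [map_mul, map_mul, map_mul, map_inv, map_inv, map_mul, map_mul, map_mul, map_inv, map_inv,
        mul_comm (χ₁ (q γ)) (χ₁ (q δ))]
      group
    rw [map_mul, map_mul, map_mul, map_inv, map_inv] at h1
    calc r γ * r δ = r γ * r δ * (r γ)⁻¹ * (r δ)⁻¹ * (r δ * r γ) := by group
      _ = r δ * r γ := by rw [h1, one_mul]
  haveI : IsMulCommutative (k₁ ≃ₐ[ℚ] k₁) := ⟨⟨hcomm⟩⟩
  exact {}

end Abelian

/-! ### The assembly -/

/-- **COMPOSITION** (kernel-checked, sorry-free): the crux `GaloisWeightedBE.ExtendedRiemannHypothesis`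
(route decl, BY NAME) from the two stub statements — the Stark seam. See the module docstring. [folklore] -/
theorem ExtendedRiemannHypothesis_of :
    (∀ (K : Type) [Field K] [NumberField K] [IsAbelianGalois ℚ K],
      Literature.NumberTheory.LFunctions.NumberField.ExtendedRiemannHypothesis K) →
    (∀ (N : Type) [Field N] [NumberField N] [IsGalois ℚ N] (s : ℂ),
      0 < s.re → s.re < 1 → Literature.NumberTheory.LFunctions.dedekindZetaCont N s = 0 →
      deriv (Literature.NumberTheory.LFunctions.dedekindZetaCont N) s = 0 → s.re = 1 / 2) →
    Summit.Langlands.Langlands.Theses.GaloisWeightedBE.ExtendedRiemannHypothesis := by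
  intro h₁ h₂ K _ _ s h0 hpos hlt
  classical
  have hs1 : s ≠ 1 := by
    intro h
    rw [h, one_re] at hlt
    exact lt_irrefl _ hlt
  -- the normal closure `N₀` of `K` inside `ℚ̄`, an embedded copy `E = f(K)`, `q : Γ_ℚ → Gal(N₀/ℚ)`
  let L := AlgebraicClosure ℚ
  let N₀ : IntermediateField ℚ L := normalClosure ℚ K L
  let f : K →ₐ[ℚ] L := IsAlgClosed.lift
  have hE : f.fieldRange ≤ N₀ := f.fieldRange_le_normalClosure
  obtain ⟨q, hq⟩ : ∃ q : Field.absoluteGaloisGroup ℚ →* (N₀ ≃ₐ[ℚ] N₀),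
      q = AlgEquiv.restrictNormalHom N₀ := ⟨_, rfl⟩
  have hqA : IsArtinQuotient q := isArtinQuotient_of_eq_restrictNormalHom hq
  haveI hNF : ∀ H', NumberField (quotientFixedField q H') :=
    fun H' => numberField_quotientFixedField hqA H'
  set H : Subgroup (N₀ ≃ₐ[ℚ] N₀) := (f.fieldRange.fixingSubgroup).map q
  have hHE : quotientFixedField q H = f.fieldRange := quotientFixedField_map_fixingSubgroup hq hE
  have hbot : quotientFixedField q ⊥ = N₀ := quotientFixedField_bot_of_eq_restrictNormalHom hq
  haveI hN₀gal : IsGalois ℚ N₀ :=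
    { to_isSeparable := Algebra.isSeparable_tower_bot_of_isSeparable ℚ N₀ L }
  haveI : NumberField N₀ := NumberField.of_module_finite ℚ N₀
  have eK : K ≃ₐ[ℚ] f.fieldRange := f.equivFieldRange
  -- `ζ_{F_H}(s) = ζ_K(s) = 0`
  have e1 : quotientFixedField q H ≃+* K :=
    ((IntermediateField.equivOfEq hHE).trans eK.symm).toRingEquiv
  have hH0 : dedekindZetaCont (quotientFixedField q H) s = 0 := by
    rw [dedekindZetaCont_eq_of_ringEquiv e1 hs1]
    exact h0
  have e3 : quotientFixedField q (⊥ : Subgroup (N₀ ≃ₐ[ℚ] N₀)) ≃+* N₀ :=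
    (IntermediateField.equivOfEq hbot).toRingEquiv
  by_cases hle : artinOrder s ((Representation.leftRegular ℂ (N₀ ≃ₐ[ℚ] N₀)).character ∘ q) ≤ 1
  · -- `ord_s ζ_{N₀} ≤ 1`: Heilbronn–Stark, the zero is carried by an abelian subfield
    rcases heilbronnChar_eq_zero_or_eq_linear hqA hs1 hle with hθ | ⟨χ₁, hθ⟩
    · exact absurd hH0 (dedekindZetaCont_quotientFixedField_ne_zero_of_eq_zero hqA hs1 hθ H)
    · have hk0 : dedekindZetaCont (quotientFixedField q χ₁.ker) s = 0 :=
        (dedekindZetaCont_quotientFixedField_eq_zero_iff hqA hs1 hθ χ₁.ker).mpr le_rfl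
      have hab : IsAbelianGalois ℚ (quotientFixedField q χ₁.ker) :=
        isAbelianGalois_quotientFixedField_ker hqA χ₁
      haveI : @IsAbelianGalois ℚ (quotientFixedField q χ₁.ker) _ _ DivisionRing.toRatAlgebra :=
        isAbelianGalois_transport _ _ hab
      exact h₁ (quotientFixedField q χ₁.ker) s hk0 hpos hlt
  · -- `ord_s ζ_{N₀} ≥ 2`: a multiple zero of the Galois field `N₀`
    have h2 : ((2 : ℤ) : WithTop ℤ) ≤ meromorphicOrderAt (dedekindZetaCont N₀) s := by
      have h1 := artinOrder_leftRegular hqA s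
      rw [meromorphicOrderAt_dedekindZetaCont_eq_of_ringEquiv e3 hs1] at h1
      rw [← h1]
      have h2' : (2 : ℤ) ≤ artinOrder s
          ((Representation.leftRegular ℂ (N₀ ≃ₐ[ℚ] N₀)).character ∘ q) := by omega
      exact_mod_cast h2'
    obtain ⟨hz, hd⟩ := eq_zero_and_deriv_eq_zero_of_two_le (analyticAt_dedekindZetaCont hs1) h2
    haveI : @IsGalois ℚ _ N₀ _ DivisionRing.toRatAlgebra := isGalois_transport _ _ hN₀gal
    exact h₂ N₀ s hpos hlt hz hd

/-- **Registered (closed) form**: the crux from the two registered stubs through the sorry-free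
composition `ExtendedRiemannHypothesis_of`. [folklore] -/
theorem ExtendedRiemannHypothesis_from_stubs :
    Summit.Langlands.Langlands.Theses.GaloisWeightedBE.ExtendedRiemannHypothesis :=
  ExtendedRiemannHypothesis_of stub_abelianERH stub_galoisMultipleZerosOnLine

/-- The decomposition is EXACT: both stub statements follow from the crux (weakening direction,
recorded for the census; the content is `ExtendedRiemannHypothesis_of`). [folklore] -/
theorem stubs_of_ExtendedRiemannHypothesis
    (h : Summit.Langlands.Langlands.Theses.GaloisWeightedBE.ExtendedRiemannHypothesis) :
    (∀ (K : Type) [Field K] [NumberField K] [IsAbelianGalois ℚ K],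
      Literature.NumberTheory.LFunctions.NumberField.ExtendedRiemannHypothesis K) ∧
    (∀ (N : Type) [Field N] [NumberField N] [IsGalois ℚ N] (s : ℂ),
      0 < s.re → s.re < 1 → Literature.NumberTheory.LFunctions.dedekindZetaCont N s = 0 →
      deriv (Literature.NumberTheory.LFunctions.dedekindZetaCont N) s = 0 → s.re = 1 / 2) :=
  ⟨fun K _ _ _ => h K, fun N _ _ _ s h0 h1 hz _ => h N s hz h0 h1⟩

end Summit.Langlands.Langlands.Cruxes.ExtendedRiemannHypothesis.StarkSeamLine

end
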